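import Literature.NumberTheory.EllipticCurves.EisensteinNewformLevelRaising
import Literature.NumberTheory.EllipticCurves.EisensteinNewformLevelRaisingDictionaryProofs
import Literature.NumberTheory.EllipticCurves.EisensteinNewformLevelRaisingCoreProofs
import Literature.NumberTheory.EllipticCurves.EisensteinSeriesNebentypusLevelRaisedLargeWeight
import HarnessLib

/-!
# Billerey–Menares 2016, Thm. 2.2 (the rendering `BillereyMenares2016_thm22_exists_newform`)
# from the Katz–Carayol lifting lemma (proofs only)

Topic `Literature/NumberTheory/EllipticCurves`; namespace `Literature.NumberTheory.EllipticCurves`.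
THEOREMS ONLY (no definition, no named fact; D-0026).

`BillereyMenares2016_thm22_of_cuspFormLift` proves the named fact
`Literature.NumberTheory.EllipticCurves.BillereyMenares2016_thm22_exists_newform`
(`EisensteinNewformLevelRaising.lean`: N. Billerey, R. Menares, *On the modularity of reducible
mod `l` Galois representations*, Math. Res. Lett. 23 (2016), Thm. 2.2 with Prop. 1.2) from ONE
hypothesis, the lifting lemma of the printed proof (p. 7: "by a well-known lemma of Deligne and
Serre … there exists a cusp form …"; in the 2018 sequel, §3.2: Carayol's lemma [Edixhoven, *Serre's
conjecture*, in Cornell–Silverman–Stevens 1997, Prop. 1.10], resting on Katz' `q`-expansion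
principle): for `p ≥ 5`, `p ∤ N`, `k ≥ 2`, a modular form `F ∈ M_k(Γ₁(N))` with nebentypus `χ` on
`Γ₀(N)`, `p`-integral `q`-expansion (through `ι : ℚ̄_p ≃ ℂ`) and constant terms in the maximal
ideal at every cusp is congruent modulo the maximal ideal to a cusp form `G ∈ S_k(N, χ)`.  That
lemma is not in the tree (it is the only missing ingredient); everything else is assembled here:

1. **dictionary** (`exists_dirichletCharacter_of_padicCharacter`): the reduction of `η` is
   `χ̃ ω^{k-1}` for a primitive Dirichlet character `χ` modulo `N`, `p ∤ N`, of parity `(-1)^k`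
   and order prime to `p`, with `χ(ℓ)ℓ^{k-1} ≡ η(Frob_ℓ)`, `M ∤ N` and `χ(M)M^k ≡ 1`;
2. **the level-raised Eisenstein series** `F₂ = eisensteinLevelRaised N k χ M` on `Γ₁(NM)`:
   nebentypus `χ` (`eisensteinLevelRaised_slash_of_mem_gamma0`), `p`-integral coefficients for
   `k ∈ {3,…,p+1}` (`valuation_qExpansion_coeff_eisensteinLevelRaised_le_one_of_le`, von
   Staudt–Clausen / Carlitz for `k ≥ p - 1`) and constant terms in `𝔪` at all cusps
   (`exists_tendsto_eisensteinLevelRaised_slash_valuation_lt_one_of_weight`, and `_corner` for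
   `(k, χ) = (p-1, 𝟙)` using `M^{p-1} ≡ 1 (mod p²)`);
3. **the lift** (the hypothesis) gives `G ∈ S_k(NM, χ)`, `G ≡ F₂ (mod 𝔪)`;
4. **Deligne–Serre + newform theory** (`exists_isNewform1_of_congruent_eisensteinLevelRaised`):
   a newform `g` of level `N` or `NM` with `a_ℓ(g) ≡ 1 + χ(ℓ)ℓ^{k-1}`, `a_p(g) ≡ 1`, nebentypus
   of conductor `N`, order prime to `p`, values `χ(ℓ)`;
5. back to `η` through the dictionary's Frobenius congruences.

## References

* N. Billerey, R. Menares, *On the modularity of reducible mod `l` Galois representations*, Math.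
  Res. Lett. 23 (2016), 15–41, Thm. 2.2, Prop. 1.2, §2 (proof, p. 7). [BillereyMenares2016]
* N. Billerey, R. Menares, *Strong modularity of reducible Galois representations*, Trans. AMS
  370 (2018), 967–986, §3.2. [BillereyMenares2018]
* B. Edixhoven, *Serre's conjecture*, in: Modular Forms and Fermat's Last Theorem (Cornell,
  Silverman, Stevens eds.), Springer 1997, 209–242, Prop. 1.10. [Edixhoven1997]
-/

noncomputable section

open scoped MatrixGroups ModularForm Topology
open CongruenceSubgroup UpperHalfPlane Filter NumberField IsDedekindDomain Field

namespace Literature.NumberTheory.EllipticCurves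

open Literature.NumberTheory.GaloisRepresentations
open Literature.NumberTheory.EllipticCurves.ModularForms

section Norm

variable {p : ℕ} [Fact p.Prime]

/-- `Valued.v x < 1 ↔ ‖x‖ < 1` in `ℚ̄_p`. [folklore] -/
private theorem v_lt_one_iff₂ (x : PadicAlgCl p) : Valued.v x < 1 ↔ ‖x‖ < 1 := by
  rw [PadicAlgCl.valuation_def, ← NNReal.coe_lt_coe, coe_nnnorm, NNReal.coe_one]

/-- `Valued.v x ≤ 1 ↔ ‖x‖ ≤ 1` in `ℚ̄_p`. [folklore] -/
private theorem v_le_one_iff₂ (x : PadicAlgCl p) : Valued.v x ≤ 1 ↔ ‖x‖ ≤ 1 := by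
  rw [PadicAlgCl.valuation_def, ← NNReal.coe_le_coe, coe_nnnorm, NNReal.coe_one]

/-- Chaining two congruences modulo `𝔪`. [folklore] -/
private theorem norm_sub_lt_one_trans₂ {x y z : PadicAlgCl p} (h₁ : ‖x - y‖ < 1)
    (h₂ : ‖y - z‖ < 1) : ‖x - z‖ < 1 := by
  have : x - z = (x - y) + (y - z) := by ring
  rw [this]
  exact (PadicAlgCl.isNonarchimedean p _ _).trans_lt (max_lt h₁ h₂)

end Norm

/-- **Constant terms of `F₂` in the maximal ideal, for every admissible `(k, χ)`** — the case
analysis of Billerey–Menares 2016, Prop. 1.2 / Thm. 2.2 feeding `eisensteinLevelRaised`: for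
`k ≤ p - 2`, `(k, χ) ≠ (p - 1, 𝟙)`, `k = p`, `k = p + 1` the constant-term factor
`-B_{k,χ}/(4k) · (χ(M)M^k - 1)` is `p`-integral times `χ(M)M^k - 1 ≡ 0`; for `(k, χ) = (p-1, 𝟙)`
(so `N = 1`) it is `-B_{p-1}(M^{p-1} - 1)/(4(p-1)) ∈ p ℤ_(p)` as `M^{p-1} ≡ 1 (mod p²)`.
[cite: BillereyMenares2016, Prop. 1.2, Thm. 2.2] -/
theorem exists_tendsto_eisensteinLevelRaised_slash_valuation_lt_one_of_range {p : ℕ}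
    [Fact p.Prime] (ι : PadicAlgCl p ≃+* ℂ) (hp5 : 5 ≤ p) {k : ℕ} (hk : 3 ≤ k)
    (hkr : k = p ∨ k = p + 1 ∨ (3 ≤ k ∧ k + 1 ≤ p)) {M : ℕ} [NeZero M] (hM : M.Prime)
    (hMp : M ≠ p) (N : ℕ) [NeZero N] (χ : DirichletCharacter ℂ N) (hχ : χ.IsPrimitive) (hN : ¬ p ∣ N)
    (hMN : M.Coprime N)
    (hcong : Valued.v (ι.symm ((χ (M : ZMod N) : ℂ) * (M : ℂ) ^ (k : ℤ)) - 1) < 1)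
    (hM2 : k + 1 = p → χ = 1 → M ^ (p - 1) % p ^ 2 = 1) (γ : SL(2, ℤ)) :
    ∃ c : ℂ, Tendsto ((⇑(eisensteinLevelRaised N k χ M hk) : ℍ → ℂ) ∣[(k : ℤ)] γ) atImInfty
      (𝓝 c) ∧ Valued.v (ι.symm c) < 1 := by
  have hp : p.Prime := Fact.out
  by_cases hc : k + 1 = p ∧ χ = 1
  · obtain ⟨hkp, hχ1⟩ := hc
    have hN1 : N = 1 := by
      have h := hχ
      rw [DirichletCharacter.isPrimitive_def, hχ1, DirichletCharacter.conductor_one] at h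
      exact h.symm
    subst hN1
    exact exists_tendsto_eisensteinLevelRaised_slash_valuation_lt_one_corner (k := k) (M := M) χ ι
      (by omega) hkp hk hM hMp (hM2 hkp hχ1) γ
  · refine exists_tendsto_eisensteinLevelRaised_slash_valuation_lt_one_of_weight k χ M ι hp5 hN hk
      ?_ hM hMp hMN hcong γ
    rcases hkr with h | h | ⟨-, h⟩
    · exact Or.inr (Or.inr (Or.inl h))
    · exact Or.inr (Or.inr (Or.inr h))
    · rcases Nat.lt_or_eq_of_le h with h' | h'
      · exact Or.inl (by omega)
      · refine Or.inr (Or.inl ⟨by omega, fun hχ1 ↦ hc ⟨h', hχ1⟩⟩)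

/-- **Billerey–Menares 2016, Thm. 2.2, from the Katz–Carayol lifting lemma.**  The hypothesis
`hlift` is the lifting lemma of the printed proof (Edixhoven 1997, Prop. 1.10; Billerey–Menares
2018, §3.2), stated for `p ≥ 5`, `p ∤ N`, `k ≥ 2`: a modular form on `Γ₁(N)` with nebentypus
`χ` on `Γ₀(N)`, `p`-integral `q`-expansion at `∞` and constant terms in the maximal ideal at every
cusp is congruent to a cusp form in `S_k(N, χ)`.  The conclusion is the named fact
`BillereyMenares2016_thm22_exists_newform` verbatim (see the module docstring for the assembly).
[cite: BillereyMenares2016, §2, Thm. 2.2 (p. 7); Prop. 1.2]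
[cite: Edixhoven1997, Prop. 1.10] -/
theorem BillereyMenares2016_thm22_of_cuspFormLift
    (hlift : ∀ (p : ℕ) [Fact p.Prime], 5 ≤ p → ∀ (ι : PadicAlgCl p ≃+* ℂ) (N : ℕ) [NeZero N],
      ¬ p ∣ N → ∀ (k : ℤ), 2 ≤ k → ∀ (χ : DirichletCharacter ℂ N) (F : ModularForm (Gamma1 N) k),
      (∀ γ : SL(2, ℤ), γ ∈ Gamma0 N →
        (⇑F : ℍ → ℂ) ∣[k] γ = χ ((γ 1 1 : ℤ) : ZMod N) • (⇑F : ℍ → ℂ)) →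
      (∀ n : ℕ, Valued.v (ι.symm ((qExpansion 1 ⇑F).coeff n)) ≤ 1) →
      (∀ γ : SL(2, ℤ), ∃ c : ℂ,
        Tendsto ((⇑F : ℍ → ℂ) ∣[k] γ) atImInfty (𝓝 c) ∧ Valued.v (ι.symm c) < 1) →
      ∃ G : CuspForm (Gamma1 N) k, G ∈ nebentypusSubspace N k χ ∧
        ∀ n : ℕ, Valued.v (ι.symm ((qExpansion 1 ⇑G).coeff n - (qExpansion 1 ⇑F).coeff n)) < 1) :
    BillereyMenares2016_thm22_exists_newform := by
  intro p _ hp5 ι ρ k M hunit hodd hkr hIp hMpr hMp hunr hFrobM hcorner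
  have hp : p.Prime := Fact.out
  have hp3 : 3 ≤ p := by omega
  have hk3 : 3 ≤ k := by rcases hkr with h | h | ⟨h, -⟩ <;> omega
  have hk1 : 1 ≤ k := by omega
  -- ### (1) the dictionary
  have hIp' : ∃ w : HeightOneSpectrum (𝓞 ℚ), (p : 𝓞 ℚ) ∈ w.asIdeal ∧ ∃ 𝔓 ∈ w.primesAbove,
      ∀ σ ∈ 𝔓.inertia (absoluteGaloisGroup ℚ),
        Valued.v (((ρ σ : (PadicAlgCl p)ˣ) : PadicAlgCl p) -
          algebraMap (Padic p) (PadicAlgCl p)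
            (((GaloisRep.cyclotomicCharacter ℚ p σ).val : PadicInt p) : Padic p) ^ (k - 1)) < 1 :=
    ⟨_, natCast_mem_asIdeal_primesEquiv_symm p hp,
      hIp _ (natCast_mem_asIdeal_primesEquiv_symm p hp)⟩
  obtain ⟨N, _, χ, hχ, hpN, hpar, ⟨m, hm0, hpm, hχm⟩, hglob, hFrobχ, hMcl⟩ :=
    exists_dirichletCharacter_of_padicCharacter hp3 ι ρ hk1 hunit hodd hIp'
  obtain ⟨hMN, hcongM⟩ := hMcl M hMpr hMp hunr
  have hcong : Valued.v (ι.symm ((χ (M : ZMod N) : ℂ) * (M : ℂ) ^ (k : ℤ)) - 1) < 1 :=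
    hcongM hFrobM
  haveI : NeZero M := ⟨hMpr.ne_zero⟩
  have hMNc : M.Coprime N := (Nat.Prime.coprime_iff_not_dvd hMpr).2 hMN
  have hpM : ¬ p ∣ M := fun h ↦ hMp ((Nat.prime_dvd_prime_iff_eq hp hMpr).1 h).symm
  have hpL : ¬ p ∣ N * M := fun h ↦ (hp.dvd_mul.1 h).elim hpN hpM
  -- `M^{p-1} ≡ 1 (mod p²)` in the corner case `(k, χ) = (p - 1, 𝟙)`
  have hM2 : k + 1 = p → χ = 1 → M ^ (p - 1) % p ^ 2 = 1 := by
    intro hkp hχ1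
    refine hcorner hkp fun τ ↦ ?_
    have h := hglob τ
    rw [hχ1, MulChar.one_apply_coe, map_one, one_mul, Valuation.map_sub_swap] at h
    exact h
  -- ### (2) the level-raised Eisenstein series and the hypotheses of the lift
  set F := eisensteinLevelRaised N k χ M hk3 with hF
  set χ' : DirichletCharacter ℂ (N * M) := DirichletCharacter.changeLevel (dvd_mul_right N M) χ
    with hχ'
  have hslash : ∀ γ : SL(2, ℤ), γ ∈ Gamma0 (N * M) →
      (⇑F : ℍ → ℂ) ∣[((k : ℕ) : ℤ)] γ = χ' ((γ 1 1 : ℤ) : ZMod (N * M)) • (⇑F : ℍ → ℂ) := by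
    intro γ hγ
    rw [hF, eisensteinLevelRaised_slash_of_mem_gamma0 k χ M hk3 hγ]
    congr 1
    have hu := isUnit_gamma0_apply_one_one hγ
    rw [hχ', ← hu.unit_spec, DirichletCharacter.changeLevel_eq_cast_of_dvd χ (dvd_mul_right N M),
      hu.unit_spec, ZMod.cast_intCast (dvd_mul_right N M)]
  have hint : ∀ n : ℕ, Valued.v (ι.symm ((qExpansion 1 ⇑F).coeff n)) ≤ 1 := fun n ↦
    valuation_qExpansion_coeff_eisensteinLevelRaised_le_one_of_le k χ M ι hk3 hχ hpar n
  have hcusps : ∀ γ : SL(2, ℤ), ∃ c : ℂ,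
      Tendsto ((⇑F : ℍ → ℂ) ∣[((k : ℕ) : ℤ)] γ) atImInfty (𝓝 c) ∧ Valued.v (ι.symm c) < 1 :=
    fun γ ↦ exists_tendsto_eisensteinLevelRaised_slash_valuation_lt_one_of_range ι hp5 hk3 hkr hMpr
      hMp N χ hχ hpN hMNc hcong hM2 γ
  -- ### (3) the lift
  obtain ⟨G, hGχ, hGF⟩ := hlift p hp5 ι (N * M) hpL (k : ℤ) (by exact_mod_cast (show 2 ≤ k by omega))
    χ' F hslash hint hcusps
  -- ### (4) Deligne–Serre and the newform
  have hGF' : ∀ n, ‖ι.symm (cuspCoeff G n - (qExpansion 1 ⇑F).coeff n)‖ < 1 := fun n ↦ by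
    rw [← v_lt_one_iff₂]; exact hGF n
  have hGint : ∀ n, ‖ι.symm (cuspCoeff G n)‖ ≤ 1 := by
    intro n
    have h1 := hGF' n
    have h2 : ‖ι.symm ((qExpansion 1 ⇑F).coeff n)‖ ≤ 1 := by rw [← v_le_one_iff₂]; exact hint n
    have h3 : ι.symm (cuspCoeff G n) = ι.symm (cuspCoeff G n - (qExpansion 1 ⇑F).coeff n) +
        ι.symm ((qExpansion 1 ⇑F).coeff n) := by rw [← map_add, sub_add_cancel]
    rw [h3]
    exact (PadicAlgCl.isNonarchimedean p _ _).trans (max_le h1.le h2)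
  obtain ⟨N', _, g, hnew, hpN', hN', hcond, hgm, hgood, hap⟩ :=
    exists_isNewform1_of_congruent_eisensteinLevelRaised ι hk3 hχ hpar hpN hpm hχm hMpr hMp hMN
      hGχ hGint hGF'
  have hNN' : N ∣ N' := by rcases hN' with rfl | rfl; exacts [dvd_rfl, dvd_mul_right N M]
  -- ### (5) back to `η`
  refine ⟨N', ‹_›, g, hnew, hpN', ?_, ⟨m, hm0, hpm, hgm⟩, ?_, ?_⟩
  · rcases hN' with rfl | rfl
    · exact Or.inl hcond.symm
    · exact Or.inr (by rw [hcond])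
  · rw [v_lt_one_iff₂]; exact hap
  · intro ℓ hℓ hℓN' hℓp w hw 𝔓 h𝔓 σ hσ
    have hℓN : ¬ ℓ ∣ N := fun h ↦ hℓN' (h.trans hNN')
    obtain ⟨h1, h2⟩ := hgood ℓ hℓ hℓN'
    have h3 := hFrobχ ℓ hℓ hℓN hℓp w hw 𝔓 h𝔓 σ hσ
    rw [v_lt_one_iff₂] at h3
    have hzpow : ((ℓ : ℂ)) ^ ((k : ℤ) - 1) = (ℓ : ℂ) ^ (k - 1) := by
      rw [show ((k : ℤ) - 1) = ((k - 1 : ℕ) : ℤ) by omega, zpow_natCast]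
    refine ⟨?_, ?_⟩
    · rw [v_lt_one_iff₂]
      refine norm_sub_lt_one_trans₂ h1 ?_
      rw [add_sub_add_left_eq_sub, ← hzpow]
      exact h3
    · rw [v_lt_one_iff₂, h2]
      exact h3

end Literature.NumberTheory.EllipticCurves
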